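import Mathlib
import Summits.Ventures.PercRepro2.K5Theorem
import Summits.Ventures.PercRepro2.HubBernstein
import Summits.Ventures.PercRepro2.PMK5Kernel
import Summits.Ventures.PercRepro2.PMK5KernelA
import Summits.Ventures.PercRepro2.PMK5Bridge
import Summits.Ventures.PercRepro2.PMK5Theorem
import Summits.Ventures.PercRepro2.PMK5Typed
import Summits.Ventures.PercRepro2.PMK5Strict

/-!
# THE EQUALITY LOCUS OF THE WEIGHTED (PM) ON FIVE-VERTEX BASES (blind cell PercRepro2, mine-2 g23; row 2′BETA1,
the «equality locus first» reading of Theorem 12 — kernel-checked)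

`K₅` on the five marks `(o, a₁, a₂, u, b) = (0, 1, 2, 3, 4)` (`K5.ends5`); an edge set `S ⊆ K₅` is a bitmask
`m < 1024` over the ten edges (bit `e` = edge `e` of `ends5`, lexicographic), and a weight vector `p` is
**interior on `m`** when `0 < p_e < 1` on the edges of `m` and `p_e = 0` off `m` — the open face of the cube of
the subgraph `S`.  Theorem 12 (`PMK5Typed.beta1_eq_bern`, `cntNegB_le_cntPosB`) writes the cleared typed
bracket `β₁ = (HALF-PM⁺)_L + (HALF-PM⁺)_H + A` as a degree-3 tensor-Bernstein form with NONNEGATIVE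
coefficients `c_k = cntPosB k − cntNegB k`; on the face of `m` the basis functions with support inside `m` are
strictly positive and the others vanish, so on every face `β₁` is either identically zero or strictly positive,
and which one is decided by whether some nonzero coefficient has its support inside `m`.

**The degenerate edge sets** (`RuleB m`): `β₁ ≡ 0` on `S` exactly when one of
 (1) the root pair `{a₁, a₂}` separates `o` from `b` in `S` (Theorem 7: `RootPairSepTyped`),
 (2) `a₁` reaches neither `o` nor `u` avoiding `a₂` (then `C₁` never meets `{o, u}` on `Q`),
 (3) `a₂` reaches neither `o` nor `u` avoiding `a₁` (the mirror),
 (4) `o` is connected to neither root in `S`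
holds (the exact census of the 1,024 edge sets from the class sums, own code; 536 degenerate, 488 not).
**THE THEOREM** (`beta1_K5_pos_of_face`): on every NON-degenerate edge set `β₁ > 0` at every interior weight
vector — the equality locus of the weighted (PM) on five-vertex bases is exactly the degenerate placements.
Mechanism: nineteen witness profiles, one per MINIMAL support of a nonzero coefficient (their class sums read
off the kernel Kronecker digits of `kPosA − kNegA`, `kPosL − kNegL`, `kPosH − kNegH` — `digitsA`, `digitsL`,
`digitsH`, three `decide +kernel`), the covering `cover` (every non-degenerate `m` contains a witness support,
one `decide +kernel` over the 1,024 masks) and the face positivity of the Bernstein basis.  Standard axioms.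
The converse (`RuleB m = true → β₁ ≡ 0` on the face) is Theorem 7 (i)/(ii) plus the trivial vanishings — paper,
proofs/MINE2-CUTU.md §17; its kernel form is not in this file.
-/

namespace Summit.Ventures.PercRepro2

open Hub

namespace K5

namespace PM

/-! ## The nineteen witness digits (kernel) -/

set_option maxRecDepth 100000 in
/-- The `A`-class sums at the fifteen `A`-witness profiles, read off the Kronecker digits. -/
theorem digitsA : (kPosA - kNegA) / KB ^ 133 % KB = 4 ∧
    (kPosA - kNegA) / KB ^ 4228 % KB = 3 ∧
    (kPosA - kNegA) / KB ^ 17568 % KB = 4 ∧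
    (kPosA - kNegA) / KB ^ 65665 % KB = 3 ∧
    (kPosA - kNegA) / KB ^ 69760 % KB = 4 ∧
    (kPosA - kNegA) / KB ^ 524325 % KB = 8 ∧
    (kPosA - kNegA) / KB ^ 525348 % KB = 6 ∧
    (kPosA - kNegA) / KB ^ 528420 % KB = 5 ∧
    (kPosA - kNegA) / KB ^ 540705 % KB = 6 ∧
    (kPosA - kNegA) / KB ^ 541728 % KB = 8 ∧
    (kPosA - kNegA) / KB ^ 541824 % KB = 4 ∧
    (kPosA - kNegA) / KB ^ 544800 % KB = 6 ∧
    (kPosA - kNegA) / KB ^ 589857 % KB = 5 ∧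
    (kPosA - kNegA) / KB ^ 590880 % KB = 6 ∧
    (kPosA - kNegA) / KB ^ 593952 % KB = 8 := by
  decide +kernel

set_option maxRecDepth 100000 in
/-- The `L`-class sums at the two `L`-witness profiles. -/
theorem digitsL : (kPosL - kNegL) / KB ^ 32897 % KB = 4 ∧
    (kPosL - kNegL) / KB ^ 36992 % KB = 4 := by
  decide +kernel

set_option maxRecDepth 100000 in
/-- The `H`-class sums at the two `H`-witness profiles. -/
theorem digitsH : (kPosH - kNegH) / KB ^ 2180 % KB = 4 ∧
    (kPosH - kNegH) / KB ^ 67712 % KB = 4 := by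
  decide +kernel

/-! ## From one positive class sum to a positive `β₁`-coefficient -/

/-- A strictly positive `A`-class sum makes the `β₁`-coefficient strictly positive (`L`, `H` are `≥ 0`). -/
lemma cntB_lt_of_A (k : Fin 10 → Fin 4) (h : cntNegA k < cntPosA k) : cntNegB k < cntPosB k := by
  unfold cntPosB cntNegB
  have := cntNegL_le_cntPosL k
  have := cntNegH_le_cntPosH k
  omega

/-- A strictly positive `L`-class sum makes the `β₁`-coefficient strictly positive. -/
lemma cntB_lt_of_L (k : Fin 10 → Fin 4) (h : cntNegL k < cntPosL k) : cntNegB k < cntPosB k := by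
  unfold cntPosB cntNegB
  have := cntNegH_le_cntPosH k
  have := cntNegA_le_cntPosA k
  omega

/-- A strictly positive `H`-class sum makes the `β₁`-coefficient strictly positive. -/
lemma cntB_lt_of_H (k : Fin 10 → Fin 4) (h : cntNegH k < cntPosH k) : cntNegB k < cntPosB k := by
  unfold cntPosB cntNegB
  have := cntNegL_le_cntPosL k
  have := cntNegA_le_cntPosA k
  omega

/-- Witness 0: the profile `(1, 1, 0, 2, 0, 0, 0, 0, 0, 0)` (index `133`, support `{01 02 04}`, mask `11`) has the `A`-class sum `4`. -/
theorem w0 : cntNegB (decode4 133) < cntPosB (decode4 133) :=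
  cntB_lt_of_A _ (digit_lt_of_kron cntPosA cntNegA cntPosA_lt cntNegA_le_cntPosA kPosA_eq kNegA_eq 133
    (by norm_num) digitsA.1 (by norm_num))
/-- Witness 1: the profile `(0, 1, 0, 2, 0, 2, 0, 0, 0, 0)` (index `2180`, support `{02 04 13}`, mask `42`) has the `H`-class sum `4`. -/
theorem w1 : cntNegB (decode4 2180) < cntPosB (decode4 2180) :=
  cntB_lt_of_H _ (digit_lt_of_kron cntPosH cntNegH cntPosH_lt cntNegH_le_cntPosH kPosH_eq kNegH_eq 2180
    (by norm_num) digitsH.1 (by norm_num))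
/-- Witness 2: the profile `(0, 1, 0, 2, 0, 0, 1, 0, 0, 0)` (index `4228`, support `{02 04 14}`, mask `74`) has the `A`-class sum `3`. -/
theorem w2 : cntNegB (decode4 4228) < cntPosB (decode4 4228) :=
  cntB_lt_of_A _ (digit_lt_of_kron cntPosA cntNegA cntPosA_lt cntNegA_le_cntPosA kPosA_eq kNegA_eq 4228
    (by norm_num) digitsA.2.1 (by norm_num))
/-- Witness 3: the profile `(1, 0, 0, 2, 0, 0, 0, 2, 0, 0)` (index `32897`, support `{01 04 23}`, mask `137`) has the `L`-class sum `4`. -/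
theorem w3 : cntNegB (decode4 32897) < cntPosB (decode4 32897) :=
  cntB_lt_of_L _ (digit_lt_of_kron cntPosL cntNegL cntPosL_lt cntNegL_le_cntPosL kPosL_eq kNegL_eq 32897
    (by norm_num) digitsL.1 (by norm_num))
/-- Witness 4: the profile `(0, 0, 2, 2, 0, 1, 0, 1, 0, 0)` (index `17568`, support `{03 04 13 23}`, mask `172`) has the `A`-class sum `4`. -/
theorem w4 : cntNegB (decode4 17568) < cntPosB (decode4 17568) :=
  cntB_lt_of_A _ (digit_lt_of_kron cntPosA cntNegA cntPosA_lt cntNegA_le_cntPosA kPosA_eq kNegA_eq 17568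
    (by norm_num) digitsA.2.2.1 (by norm_num))
/-- Witness 5: the profile `(0, 0, 0, 2, 0, 0, 1, 2, 0, 0)` (index `36992`, support `{04 14 23}`, mask `200`) has the `L`-class sum `4`. -/
theorem w5 : cntNegB (decode4 36992) < cntPosB (decode4 36992) :=
  cntB_lt_of_L _ (digit_lt_of_kron cntPosL cntNegL cntPosL_lt cntNegL_le_cntPosL kPosL_eq kNegL_eq 36992
    (by norm_num) digitsL.2 (by norm_num))
/-- Witness 6: the profile `(1, 0, 0, 2, 0, 0, 0, 0, 1, 0)` (index `65665`, support `{01 04 24}`, mask `265`) has the `A`-class sum `3`. -/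
theorem w6 : cntNegB (decode4 65665) < cntPosB (decode4 65665) :=
  cntB_lt_of_A _ (digit_lt_of_kron cntPosA cntNegA cntPosA_lt cntNegA_le_cntPosA kPosA_eq kNegA_eq 65665
    (by norm_num) digitsA.2.2.2.1 (by norm_num))
/-- Witness 7: the profile `(0, 0, 0, 2, 0, 2, 0, 0, 1, 0)` (index `67712`, support `{04 13 24}`, mask `296`) has the `H`-class sum `4`. -/
theorem w7 : cntNegB (decode4 67712) < cntPosB (decode4 67712) :=
  cntB_lt_of_H _ (digit_lt_of_kron cntPosH cntNegH cntPosH_lt cntNegH_le_cntPosH kPosH_eq kNegH_eq 67712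
    (by norm_num) digitsH.2 (by norm_num))
/-- Witness 8: the profile `(0, 0, 0, 2, 0, 0, 1, 0, 1, 0)` (index `69760`, support `{04 14 24}`, mask `328`) has the `A`-class sum `4`. -/
theorem w8 : cntNegB (decode4 69760) < cntPosB (decode4 69760) :=
  cntB_lt_of_A _ (digit_lt_of_kron cntPosA cntNegA cntPosA_lt cntNegA_le_cntPosA kPosA_eq kNegA_eq 69760
    (by norm_num) digitsA.2.2.2.2.1 (by norm_num))
/-- Witness 9: the profile `(1, 1, 2, 0, 0, 0, 0, 0, 0, 2)` (index `524325`, support `{01 02 03 34}`, mask `519`) has the `A`-class sum `8`. -/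
theorem w9 : cntNegB (decode4 524325) < cntPosB (decode4 524325) :=
  cntB_lt_of_A _ (digit_lt_of_kron cntPosA cntNegA cntPosA_lt cntNegA_le_cntPosA kPosA_eq kNegA_eq 524325
    (by norm_num) digitsA.2.2.2.2.2.1 (by norm_num))
/-- Witness 10: the profile `(0, 1, 2, 0, 0, 1, 0, 0, 0, 2)` (index `525348`, support `{02 03 13 34}`, mask `550`) has the `A`-class sum `6`. -/
theorem w10 : cntNegB (decode4 525348) < cntPosB (decode4 525348) :=
  cntB_lt_of_A _ (digit_lt_of_kron cntPosA cntNegA cntPosA_lt cntNegA_le_cntPosA kPosA_eq kNegA_eq 525348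
    (by norm_num) digitsA.2.2.2.2.2.2.1 (by norm_num))
/-- Witness 11: the profile `(0, 1, 2, 0, 0, 0, 1, 0, 0, 2)` (index `528420`, support `{02 03 14 34}`, mask `582`) has the `A`-class sum `5`. -/
theorem w11 : cntNegB (decode4 528420) < cntPosB (decode4 528420) :=
  cntB_lt_of_A _ (digit_lt_of_kron cntPosA cntNegA cntPosA_lt cntNegA_le_cntPosA kPosA_eq kNegA_eq 528420
    (by norm_num) digitsA.2.2.2.2.2.2.2.1 (by norm_num))
/-- Witness 12: the profile `(1, 0, 2, 0, 0, 0, 0, 1, 0, 2)` (index `540705`, support `{01 03 23 34}`, mask `645`) has the `A`-class sum `6`. -/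
theorem w12 : cntNegB (decode4 540705) < cntPosB (decode4 540705) :=
  cntB_lt_of_A _ (digit_lt_of_kron cntPosA cntNegA cntPosA_lt cntNegA_le_cntPosA kPosA_eq kNegA_eq 540705
    (by norm_num) digitsA.2.2.2.2.2.2.2.2.1 (by norm_num))
/-- Witness 13: the profile `(0, 0, 2, 0, 0, 1, 0, 1, 0, 2)` (index `541728`, support `{03 13 23 34}`, mask `676`) has the `A`-class sum `8`. -/
theorem w13 : cntNegB (decode4 541728) < cntPosB (decode4 541728) :=
  cntB_lt_of_A _ (digit_lt_of_kron cntPosA cntNegA cntPosA_lt cntNegA_le_cntPosA kPosA_eq kNegA_eq 541728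
    (by norm_num) digitsA.2.2.2.2.2.2.2.2.2.1 (by norm_num))
/-- Witness 14: the profile `(0, 0, 0, 2, 0, 1, 0, 1, 0, 2)` (index `541824`, support `{04 13 23 34}`, mask `680`) has the `A`-class sum `4`. -/
theorem w14 : cntNegB (decode4 541824) < cntPosB (decode4 541824) :=
  cntB_lt_of_A _ (digit_lt_of_kron cntPosA cntNegA cntPosA_lt cntNegA_le_cntPosA kPosA_eq kNegA_eq 541824
    (by norm_num) digitsA.2.2.2.2.2.2.2.2.2.2.1 (by norm_num))
/-- Witness 15: the profile `(0, 0, 2, 0, 0, 0, 1, 1, 0, 2)` (index `544800`, support `{03 14 23 34}`, mask `708`) has the `A`-class sum `6`. -/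
theorem w15 : cntNegB (decode4 544800) < cntPosB (decode4 544800) :=
  cntB_lt_of_A _ (digit_lt_of_kron cntPosA cntNegA cntPosA_lt cntNegA_le_cntPosA kPosA_eq kNegA_eq 544800
    (by norm_num) digitsA.2.2.2.2.2.2.2.2.2.2.2.1 (by norm_num))
/-- Witness 16: the profile `(1, 0, 2, 0, 0, 0, 0, 0, 1, 2)` (index `589857`, support `{01 03 24 34}`, mask `773`) has the `A`-class sum `5`. -/
theorem w16 : cntNegB (decode4 589857) < cntPosB (decode4 589857) :=
  cntB_lt_of_A _ (digit_lt_of_kron cntPosA cntNegA cntPosA_lt cntNegA_le_cntPosA kPosA_eq kNegA_eq 589857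
    (by norm_num) digitsA.2.2.2.2.2.2.2.2.2.2.2.2.1 (by norm_num))
/-- Witness 17: the profile `(0, 0, 2, 0, 0, 1, 0, 0, 1, 2)` (index `590880`, support `{03 13 24 34}`, mask `804`) has the `A`-class sum `6`. -/
theorem w17 : cntNegB (decode4 590880) < cntPosB (decode4 590880) :=
  cntB_lt_of_A _ (digit_lt_of_kron cntPosA cntNegA cntPosA_lt cntNegA_le_cntPosA kPosA_eq kNegA_eq 590880
    (by norm_num) digitsA.2.2.2.2.2.2.2.2.2.2.2.2.2.1 (by norm_num))
/-- Witness 18: the profile `(0, 0, 2, 0, 0, 0, 1, 0, 1, 2)` (index `593952`, support `{03 14 24 34}`, mask `836`) has the `A`-class sum `8`. -/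
theorem w18 : cntNegB (decode4 593952) < cntPosB (decode4 593952) :=
  cntB_lt_of_A _ (digit_lt_of_kron cntPosA cntNegA cntPosA_lt cntNegA_le_cntPosA kPosA_eq kNegA_eq 593952
    (by norm_num) digitsA.2.2.2.2.2.2.2.2.2.2.2.2.2.2 (by norm_num))

/-! ## The witness profiles, their supports, and the degenerate edge sets -/

/-- The Kronecker indices of the nineteen witness profiles (one per minimal support). -/
def N : Fin 19 → ℕ := ![133, 2180, 4228, 32897, 17568, 36992, 65665, 67712, 69760, 524325, 525348, 528420, 540705, 541728, 541824, 544800, 589857, 590880, 593952]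

/-- The supports of the nineteen witness profiles, as edge bitmasks. -/
def W : Fin 19 → ℕ := ![11, 42, 74, 137, 172, 200, 265, 296, 328, 519, 550, 582, 645, 676, 680, 708, 773, 804, 836]

/-- Every witness coefficient of `β₁` is strictly positive. -/
theorem witness_lt : ∀ i : Fin 19, cntNegB (decode4 (N i)) < cntPosB (decode4 (N i)) := by
  intro i
  fin_cases i
  exacts [w0, w1, w2, w3, w4, w5, w6, w7, w8, w9, w10, w11, w12, w13, w14, w15, w16, w17, w18]

set_option maxRecDepth 100000 in
/-- The support of the `i`-th witness profile is the mask `W i`. -/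
theorem supp_W : ∀ i : Fin 19, ∀ e : Fin 10, decode4 (N i) e ≠ 0 → (W i).testBit e = true := by
  decide +kernel

/-- The open configuration of the edge set `m`. -/
def cfg (m : ℕ) : Fin 10 → Bool := fun e => m.testBit e

/-- The open configuration of `m` with every edge at the vertex `r` removed. -/
def cfgAvoid (m r : ℕ) : Fin 10 → Bool := fun e => m.testBit e && !(ea e == r) && !(eb e == r)

/-- The open configuration of `m` with every edge at `r` or at `s` removed. -/
def cfgAvoid2 (m r s : ℕ) : Fin 10 → Bool :=
  fun e => m.testBit e && !(ea e == r) && !(eb e == r) && !(ea e == s) && !(eb e == s)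

/-- **The degenerate edge sets**: `{a₁, a₂}` separates `o` from `b`; or `a₁` reaches neither `o` nor `u`
avoiding `a₂`; or `a₂` reaches neither `o` nor `u` avoiding `a₁`; or `o` reaches neither root. -/
def RuleB (m : ℕ) : Bool :=
  (!conn (cfgAvoid2 m 1 2) 0 4) ||
  (!conn (cfgAvoid m 2) 0 1 && !conn (cfgAvoid m 2) 3 1) ||
  (!conn (cfgAvoid m 1) 0 2 && !conn (cfgAvoid m 1) 3 2) ||
  (!conn (cfg m) 0 1 && !conn (cfg m) 0 2)

set_option maxRecDepth 100000 in
/-- **The covering**: every non-degenerate edge set contains the support of a witness profile. -/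
theorem cover : ∀ m : Fin 1024, RuleB m = false →
    ∃ i : Fin 19, ∀ e : Fin 10, (W i).testBit e = true → (m : ℕ).testBit e = true := by
  decide +kernel

/-! ## Face positivity of the Bernstein basis, and the theorem -/

section Face

variable {R : Type*} [Field R] [LinearOrder R] [IsStrictOrderedRing R]

/-- The Bernstein basis function of a profile supported inside `m` is positive at every weight vector
interior on `m`. -/
lemma bern_pos_of_face {p : Fin 10 → R} {m : ℕ} (hp₁ : ∀ e : Fin 10, m.testBit e = true → 0 < p e ∧ p e < 1)
    (hp₀ : ∀ e : Fin 10, m.testBit e = false → p e = 0) (k : Fin 10 → Fin 4)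
    (hk : ∀ e : Fin 10, k e ≠ 0 → m.testBit e = true) : 0 < bern p k := by
  unfold bern
  refine Finset.prod_pos fun e _ => ?_
  by_cases he : m.testBit e = true
  · exact mul_pos (pow_pos (hp₁ e he).1 _) (pow_pos (sub_pos.2 (hp₁ e he).2) _)
  · have hk0 : k e = 0 := by
      by_contra h
      exact he (hk e h)
    rw [hp₀ e (by simpa using he), hk0]
    simp

/-- **THE EQUALITY LOCUS OF THE WEIGHTED (PM) ON FIVE-VERTEX BASES — THE POSITIVE SIDE.**  For every edge set
`m < 1024` of `K₅` that is not degenerate (`RuleB m = false`) and every weight vector interior on `m`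
(`0 < p_e < 1` on the edges of `m`, `p_e = 0` off `m`), the cleared typed bracket
`β₁ = (HALF-PM⁺)_L + (HALF-PM⁺)_H + A` (the expression of `PMK5Typed.beta1_eq_bern`) is STRICTLY positive:
the weighted (PM) of row 2′BETA1 has no interior zero on any non-degenerate five-vertex base graph. -/
theorem beta1_K5_pos_of_face (m : ℕ) (hm : m < 1024) (hr : RuleB m = false) (p : Fin 10 → R)
    (hp₁ : ∀ e : Fin 10, m.testBit e = true → 0 < p e ∧ p e < 1)
    (hp₀ : ∀ e : Fin 10, m.testBit e = false → p e = 0) :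
    0 < 
    prob p (connEvent ends5 1 2)ᶜ *
          (prob p (connEvent ends5 1 2)ᶜ * prob p (connEvent ends5 1 4 ∩ connEvent ends5 2 3 ∩ (connEvent ends5 1 0 ∪ connEvent ends5 2 0) ∩ (connEvent ends5 1 2)ᶜ) -
            prob p (connEvent ends5 1 4 ∩ (connEvent ends5 1 2)ᶜ) * prob p (connEvent ends5 2 3 ∩ (connEvent ends5 1 0 ∪ connEvent ends5 2 0) ∩ (connEvent ends5 1 2)ᶜ)) -
        prob p ((connEvent ends5 1 0 ∪ connEvent ends5 2 0) ∩ (connEvent ends5 1 2)ᶜ) *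
          (prob p (connEvent ends5 1 2)ᶜ * prob p (connEvent ends5 1 4 ∩ connEvent ends5 2 3 ∩ (connEvent ends5 1 2)ᶜ) -
            prob p (connEvent ends5 1 4 ∩ (connEvent ends5 1 2)ᶜ) * prob p (connEvent ends5 2 3 ∩ (connEvent ends5 1 2)ᶜ)) -
        prob p (connEvent ends5 1 2)ᶜ *
          (prob p (connEvent ends5 1 2)ᶜ * prob p (connEvent ends5 1 4 ∩ connEvent ends5 2 0 ∩ (connEvent ends5 1 2)ᶜ) -
            prob p (connEvent ends5 1 4 ∩ (connEvent ends5 1 2)ᶜ) * prob p (connEvent ends5 2 0 ∩ (connEvent ends5 1 2)ᶜ)) +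
        prob p (connEvent ends5 1 2)ᶜ *
          (prob p (connEvent ends5 1 2)ᶜ * prob p (connEvent ends5 2 4 ∩ connEvent ends5 1 3 ∩ (connEvent ends5 1 0 ∪ connEvent ends5 2 0) ∩ (connEvent ends5 1 2)ᶜ) -
            prob p (connEvent ends5 2 4 ∩ (connEvent ends5 1 2)ᶜ) * prob p (connEvent ends5 1 3 ∩ (connEvent ends5 1 0 ∪ connEvent ends5 2 0) ∩ (connEvent ends5 1 2)ᶜ)) -
        prob p ((connEvent ends5 1 0 ∪ connEvent ends5 2 0) ∩ (connEvent ends5 1 2)ᶜ) *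
          (prob p (connEvent ends5 1 2)ᶜ * prob p (connEvent ends5 2 4 ∩ connEvent ends5 1 3 ∩ (connEvent ends5 1 2)ᶜ) -
            prob p (connEvent ends5 2 4 ∩ (connEvent ends5 1 2)ᶜ) * prob p (connEvent ends5 1 3 ∩ (connEvent ends5 1 2)ᶜ)) -
        prob p (connEvent ends5 1 2)ᶜ *
          (prob p (connEvent ends5 1 2)ᶜ * prob p (connEvent ends5 2 4 ∩ connEvent ends5 1 0 ∩ (connEvent ends5 1 2)ᶜ) -
            prob p (connEvent ends5 2 4 ∩ (connEvent ends5 1 2)ᶜ) * prob p (connEvent ends5 1 0 ∩ (connEvent ends5 1 2)ᶜ)) +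
        (prob p ((connEvent ends5 1 3 ∪ connEvent ends5 2 3) ∩ (connEvent ends5 1 2)ᶜ) - prob p (connEvent ends5 1 2)ᶜ) *
          (prob p (connEvent ends5 1 2)ᶜ * prob p (connEvent ends5 1 4 ∩ connEvent ends5 2 0 ∩ (connEvent ends5 1 2)ᶜ) - prob p (connEvent ends5 1 4 ∩ (connEvent ends5 1 2)ᶜ) * prob p (connEvent ends5 2 0 ∩ (connEvent ends5 1 2)ᶜ) +
            prob p (connEvent ends5 1 2)ᶜ * prob p (connEvent ends5 2 4 ∩ connEvent ends5 1 0 ∩ (connEvent ends5 1 2)ᶜ) - prob p (connEvent ends5 2 4 ∩ (connEvent ends5 1 2)ᶜ) * prob p (connEvent ends5 1 0 ∩ (connEvent ends5 1 2)ᶜ)) := by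
  rw [beta1_eq_bern]
  obtain ⟨i, hi⟩ := cover ⟨m, hm⟩ hr
  have hk := witness_lt i
  have hs : ∀ e : Fin 10, decode4 (N i) e ≠ 0 → m.testBit e = true := fun e he => hi e (supp_W i e he)
  have hb : 0 < bern p (decode4 (N i)) := bern_pos_of_face hp₁ hp₀ _ hs
  have h01 : ∀ e, 0 ≤ p e ∧ p e ≤ 1 := fun e => by
    by_cases he : m.testBit e = true
    · exact ⟨(hp₁ e he).1.le, (hp₁ e he).2.le⟩
    · rw [hp₀ e (by simpa using he)]
      exact ⟨le_rfl, zero_le_one⟩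
  calc (0 : R) < bern p (decode4 (N i)) * ((cntPosB (decode4 (N i)) : ℕ) - (cntNegB (decode4 (N i)) : ℕ) : R) := by
        apply mul_pos hb
        rw [sub_pos]
        exact_mod_cast hk
    _ ≤ ∑ k, bern p k * ((cntPosB k : ℕ) - (cntNegB k : ℕ) : R) :=
        Finset.single_le_sum (f := fun k => bern p k * ((cntPosB k : ℕ) - (cntNegB k : ℕ) : R))
          (fun k _ => mul_nonneg (bern_nonneg h01 k) (by rw [sub_nonneg]; exact_mod_cast cntNegB_le_cntPosB k))
          (Finset.mem_univ _)

/-- `K₅` itself is not degenerate. -/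
theorem ruleB_K5 : RuleB 1023 = false := by decide +kernel

/-- **The full block**: `β₁ > 0` at every interior weight vector of `K₅` (the `β₁`-analogue of
`PMK5Strict.halfL_K5_pos`, as the face `m = 1023`). -/
theorem beta1_K5_pos (p : Fin 10 → R) (hp : ∀ i, 0 < p i ∧ p i < 1) :
    0 < 
    prob p (connEvent ends5 1 2)ᶜ *
          (prob p (connEvent ends5 1 2)ᶜ * prob p (connEvent ends5 1 4 ∩ connEvent ends5 2 3 ∩ (connEvent ends5 1 0 ∪ connEvent ends5 2 0) ∩ (connEvent ends5 1 2)ᶜ) -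
            prob p (connEvent ends5 1 4 ∩ (connEvent ends5 1 2)ᶜ) * prob p (connEvent ends5 2 3 ∩ (connEvent ends5 1 0 ∪ connEvent ends5 2 0) ∩ (connEvent ends5 1 2)ᶜ)) -
        prob p ((connEvent ends5 1 0 ∪ connEvent ends5 2 0) ∩ (connEvent ends5 1 2)ᶜ) *
          (prob p (connEvent ends5 1 2)ᶜ * prob p (connEvent ends5 1 4 ∩ connEvent ends5 2 3 ∩ (connEvent ends5 1 2)ᶜ) -
            prob p (connEvent ends5 1 4 ∩ (connEvent ends5 1 2)ᶜ) * prob p (connEvent ends5 2 3 ∩ (connEvent ends5 1 2)ᶜ)) -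
        prob p (connEvent ends5 1 2)ᶜ *
          (prob p (connEvent ends5 1 2)ᶜ * prob p (connEvent ends5 1 4 ∩ connEvent ends5 2 0 ∩ (connEvent ends5 1 2)ᶜ) -
            prob p (connEvent ends5 1 4 ∩ (connEvent ends5 1 2)ᶜ) * prob p (connEvent ends5 2 0 ∩ (connEvent ends5 1 2)ᶜ)) +
        prob p (connEvent ends5 1 2)ᶜ *
          (prob p (connEvent ends5 1 2)ᶜ * prob p (connEvent ends5 2 4 ∩ connEvent ends5 1 3 ∩ (connEvent ends5 1 0 ∪ connEvent ends5 2 0) ∩ (connEvent ends5 1 2)ᶜ) -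
            prob p (connEvent ends5 2 4 ∩ (connEvent ends5 1 2)ᶜ) * prob p (connEvent ends5 1 3 ∩ (connEvent ends5 1 0 ∪ connEvent ends5 2 0) ∩ (connEvent ends5 1 2)ᶜ)) -
        prob p ((connEvent ends5 1 0 ∪ connEvent ends5 2 0) ∩ (connEvent ends5 1 2)ᶜ) *
          (prob p (connEvent ends5 1 2)ᶜ * prob p (connEvent ends5 2 4 ∩ connEvent ends5 1 3 ∩ (connEvent ends5 1 2)ᶜ) -
            prob p (connEvent ends5 2 4 ∩ (connEvent ends5 1 2)ᶜ) * prob p (connEvent ends5 1 3 ∩ (connEvent ends5 1 2)ᶜ)) -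
        prob p (connEvent ends5 1 2)ᶜ *
          (prob p (connEvent ends5 1 2)ᶜ * prob p (connEvent ends5 2 4 ∩ connEvent ends5 1 0 ∩ (connEvent ends5 1 2)ᶜ) -
            prob p (connEvent ends5 2 4 ∩ (connEvent ends5 1 2)ᶜ) * prob p (connEvent ends5 1 0 ∩ (connEvent ends5 1 2)ᶜ)) +
        (prob p ((connEvent ends5 1 3 ∪ connEvent ends5 2 3) ∩ (connEvent ends5 1 2)ᶜ) - prob p (connEvent ends5 1 2)ᶜ) *
          (prob p (connEvent ends5 1 2)ᶜ * prob p (connEvent ends5 1 4 ∩ connEvent ends5 2 0 ∩ (connEvent ends5 1 2)ᶜ) - prob p (connEvent ends5 1 4 ∩ (connEvent ends5 1 2)ᶜ) * prob p (connEvent ends5 2 0 ∩ (connEvent ends5 1 2)ᶜ) +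
            prob p (connEvent ends5 1 2)ᶜ * prob p (connEvent ends5 2 4 ∩ connEvent ends5 1 0 ∩ (connEvent ends5 1 2)ᶜ) - prob p (connEvent ends5 2 4 ∩ (connEvent ends5 1 2)ᶜ) * prob p (connEvent ends5 1 0 ∩ (connEvent ends5 1 2)ᶜ)) :=
  beta1_K5_pos_of_face 1023 (by norm_num) ruleB_K5 p (fun e _ => hp e)
    (fun e he => by exfalso; revert he; revert e; decide)

end Face

end PM

end K5

end Summit.Ventures.PercRepro2
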